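import Summits.CriticalPhenomena.PercolationContinuityZ3.Theorems.PercNearOneGluingNoHeavyQuantMixedShift
import Summits.CriticalPhenomena.PercolationContinuityZ3.Theorems.PercNearOneGluingNoHeavyQuantSingleLowCapacity
import Summits.CriticalPhenomena.PercolationContinuityZ3.Theorems.PercNearOneGluingNoHeavyQuantFlowUncross
import HarnessLib

/-!
# QUANT lane R8, T-DEC, leg (III): the one-layer two-law conjecture `LawDec.MixedShiftDEC` IS FALSE —
# `not_mixedShiftDEC`, the exact witness of prim-quant-arm-3 g62 (V278 second-seat literal test) in the kernel

builds on p205010 (kernel theorem, internal audit signed; external expert review pending)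

Refutation + support file (`--supports stmt-CriticalPhenomena-4575`), QUANT lane lead seat prim-quant-lead (gen 30), rung R8 of
`run/shared/lean/prim/quant/LADDER.md`.  Theorems only, standard axioms, no sorries.  Refutes the `@[conjecture]` definition
`LawDec.MixedShiftDEC` of `…QuantMixedShift` (lead g29, p335352): the witness was found by prim-quant-arm-3 g62 on an independent exact
`FlowAtT` engine (memo `run/shared/lean/prim/quant/prim-quant-arm-3-g62/MIXEDSHIFT-CEX-G62.md`; lane README V313) and is re-derived here from
the tree's own criteria: the single-low capacity criterion `decAtT_singleLow_iff` (hypotheses A and B each have exactly one charged low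
atom) and weak duality `dual_le_of_decAtT` with an explicit price system (the conclusion has two charged lows).

THE WITNESS.  Floor `y = 11/12`, `ν = {2: 1/12, 3: 1/36, 5: 1/12, 6: 29/36}` on `{0..6}` (mean `S = 11/2`, so `y·M = S`: top-affordability
TIGHT), blob `a = 1`, retained zero mass `z = 0`, gate `g = 11/12 = y/(1−z)` (threshold TIGHT), layer `j = 5`.
* Hypothesis A: `ν` is DEC at `(11/12, 11/2, 5)` — its only charged low is `2` (`2·2 < 11/2 ≤ 2·3`); capacity inequality
  `11·(1/12) ≤ (187/127)·(1/12) + 29/36` (mid `5` at usage `127/17`, giant `6`).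
* Hypothesis B: `W = shiftBut ν 1 0 = {3: 1/12, 4: 1/36, 6: 1/12, 7: 29/36}` is DEC at `(11/12, 13/2, 5)` — only charged low `3`; capacity
  inequality `11/12 ≤ (187/127)·(1/36) + 1/12 + 29/36` (mid `4` at usage `127/17`, giants `6, 7`).
* Conclusion FAILS: `P = (1/12)·ν + (11/12)·W = {2: 1/144, 3: 17/216, 4: 11/432, 5: 1/144, 6: 31/216, 7: 319/432}` is NOT DEC at
  `(11/12, 77/12, 5)`: lows `{2, 3}` (`2·3 = 6 < 77/12`), mids `{4, 5}`, giants `{6, 7}`; usages `u(2,5) = 49/5`, `u(3,4) = 7`, `u(3,5) = 247/41`,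
  giants `11`, the pair `(2,4)` incompatible (`2 + 4 < 77/12`); the price system `α₂ = α₃ = 1`, `β₄ = 1/7`, `β₅ = 41/247`, `β₆ = β₇ = 1/11` is
  dual-feasible and `Σ α·P = 37/432 > Σ β·P = 11/3024 + 41/35568 + 31/2376 + 29/432`, contradicting `dual_le_of_decAtT`.
MECHANISM (arm-3 g62): the atom `3` is an absorber for hypothesis A (`2·3 ≥ S`) but a LOW of the unshifted copy inside the mixture (target
`77/12 > 6`), and `ν` is NOT DEC at the layer `j − a = 4`; every witness found has this shape, and the two-layer repair (hypothesis A also at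
the layer `j − a`) kills all of them (lane census, lead g30).  CONSEQUENCES: `LawDec.sdecUpTo_slice_of_mixedShift` (PM in full ⟸
`MixedShiftDEC`) is an implication from a false premise; the blob case of leg (III) stays OPEN and is carried by arm-1's `TwinMoveDEC`, the typer's
move lemma (M), and the window / two-layer forms (README V313–V314).  Nothing here is a rate statement; the RATE class log\* and the honest sentence
of `run/shared/lean/prim/quant/README.md` are unchanged.

* the witness law `ν` is written as a local notation `msCex` (no definition).
* `LawDec.msCex_hypA`, `LawDec.msCex_hypB` — hypotheses A and B of `MixedShiftDEC` at the witness.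
* `LawDec.msCex_not_conclusion` — the mixture is not DEC at the mixed target.
* **`LawDec.not_mixedShiftDEC : ¬ MixedShiftDEC`.**

[this work]; witness: prim-quant-arm-3 g62 (this lane); criteria `decAtT_singleLow_iff` (lead g22 / census-2), `dual_le_of_decAtT` (typer g22),
`usage_mid_eq` (lead g21).  Nothing here is cited as a published result.  The gluing rows served [cite: KozmaNitzan2024, Conjecture 3 (p. 15)];
product measure [cite: Grimmett1999, §1.3 p. 10].
-/

noncomputable section

namespace Summit.CriticalPhenomena.PercolationContinuityZ3.Theorems

namespace Quant

open Finset

namespace LawDec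

/-! ### The witness law and its bookkeeping -/

/-- the witness law `ν = {2: 1/12, 3: 1/36, 5: 1/12, 6: 29/36}` (prim-quant-arm-3 g62), as a local notation (no definition is
introduced). -/
local notation3 "msCex" =>
  (fun h : ℕ => if h = 2 then (1 : ℝ) / 12 else if h = 3 then 1 / 36 else if h = 5 then 1 / 12 else if h = 6 then 29 / 36 else 0)

/-- the shifted law `shiftBut ν 1 0 = {3: 1/12, 4: 1/36, 6: 1/12, 7: 29/36}`, as a closed formula. [this work] -/
theorem shiftBut_msCex (h : ℕ) :
    shiftBut msCex 1 0 h = if h = 3 then 1 / 12 else if h = 4 then 1 / 36 else if h = 6 then 1 / 12 else if h = 7 then 29 / 36 else 0 := by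
  simp only [shiftBut]
  by_cases h0 : h = 0
  · subst h0; norm_num
  have h1 : 1 ≤ h := Nat.one_le_iff_ne_zero.2 h0
  rw [if_neg h0, if_pos h1]
  by_cases e3 : h = 3
  · subst e3; norm_num
  by_cases e4 : h = 4
  · subst e4; norm_num
  by_cases e6 : h = 6
  · subst e6; norm_num
  by_cases e7 : h = 7
  · subst e7; norm_num
  have n2 : h - 1 ≠ 2 := by omega
  have n3 : h - 1 ≠ 3 := by omega
  have n5 : h - 1 ≠ 5 := by omega
  have n6 : h - 1 ≠ 6 := by omega
  by_cases e1 : h = 1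
  · subst e1; norm_num
  · simp [e3, e4, e6, e7, n2, n3, n5, n6, e1]

/-- `ν ≥ 0`. [this work] -/
theorem msCex_nonneg (h : ℕ) : 0 ≤ msCex h := by
  show (0 : ℝ) ≤ (if h = 2 then (1 : ℝ) / 12 else if h = 3 then 1 / 36 else if h = 5 then 1 / 12 else if h = 6 then 29 / 36 else 0)
  split_ifs <;> norm_num

/-- `ν` vanishes above `6`. [this work] -/
theorem msCex_zero (h : ℕ) (hh : 6 < h) : msCex h = 0 := by
  show (if h = 2 then (1 : ℝ) / 12 else if h = 3 then 1 / 36 else if h = 5 then 1 / 12 else if h = 6 then 29 / 36 else 0) = 0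
  rw [if_neg (by omega), if_neg (by omega), if_neg (by omega), if_neg (by omega)]

/-- `ν` has mass `1` on `{0..6}`. [this work] -/
theorem msCex_sum : ∑ h ∈ Finset.range (6 + 1), msCex h = 1 := by
  simp [Finset.sum_range_succ]; norm_num

/-- `ν` has mean `11/2`. [this work] -/
theorem msCex_mean : ∑ h ∈ Finset.range (6 + 1), (h : ℝ) * msCex h = 11 / 2 := by
  simp [Finset.sum_range_succ]; norm_num

/-! ### The usage rates that enter -/

/-- giants of layer `5` are used at rate `11` at floor `11/12`. [this work] -/
theorem usage_msCex_giant (T : ℝ) (l h : ℕ) (hh : 5 + 1 ≤ h) : usage (11 / 12 : ℝ) T 5 l h = 11 := by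
  rw [usage_giant_eq _ _ _ _ _ hh]; norm_num

/-- `u(2,5) = 127/17` at target `11/2`. [this work] -/
theorem usage_msCex_A : usage (11 / 12 : ℝ) (11 / 2) 5 2 5 = 127 / 17 := by
  rw [usage_mid_eq (11 / 12 : ℝ) (11 / 2) 5 2 5 (by norm_num) (by norm_num) le_rfl (by norm_num) (by norm_num)]
  norm_num

/-- `u(3,4) = 127/17` at target `13/2`. [this work] -/
theorem usage_msCex_B : usage (11 / 12 : ℝ) (13 / 2) 5 3 4 = 127 / 17 := by
  rw [usage_mid_eq (11 / 12 : ℝ) (13 / 2) 5 3 4 (by norm_num) (by norm_num) (by norm_num) (by norm_num) (by norm_num)]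
  norm_num

/-- `u(2,5) = 49/5` at target `77/12`. [this work] -/
theorem usage_msCex_P25 : usage (11 / 12 : ℝ) (77 / 12) 5 2 5 = 49 / 5 := by
  rw [usage_mid_eq (11 / 12 : ℝ) (77 / 12) 5 2 5 (by norm_num) (by norm_num) le_rfl (by norm_num) (by norm_num)]
  norm_num

/-- `u(3,4) = 7` at target `77/12`. [this work] -/
theorem usage_msCex_P34 : usage (11 / 12 : ℝ) (77 / 12) 5 3 4 = 7 := by
  rw [usage_mid_eq (11 / 12 : ℝ) (77 / 12) 5 3 4 (by norm_num) (by norm_num) (by norm_num) (by norm_num) (by norm_num)]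
  norm_num

/-- `u(3,5) = 247/41` at target `77/12`. [this work] -/
theorem usage_msCex_P35 : usage (11 / 12 : ℝ) (77 / 12) 5 3 5 = 247 / 41 := by
  rw [usage_mid_eq (11 / 12 : ℝ) (77 / 12) 5 3 5 (by norm_num) (by norm_num) le_rfl (by norm_num) (by norm_num)]
  norm_num

/-! ### Hypotheses A and B hold at the witness -/

/-- **Hypothesis A**: `ν` is DEC at `(11/12, 11/2, 5)` (top `6 + 1`): single charged low `2`, capacity `11/12 ≤ (187/127)/12 + 29/36`. [this work] -/
theorem msCex_hypA : DECAtT (11 / 12 : ℝ) (11 / 2) 5 (6 + 1) msCex := by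
  have hνM : ∀ k, 6 + 1 < k → msCex k = 0 := fun k hk => msCex_zero k (by omega)
  have hν1 : ∑ h ∈ Finset.range (6 + 1 + 1), msCex h = 1 := by
    simp [Finset.sum_range_succ]; norm_num
  have hsingle : ∀ k : ℕ, k ≤ 5 → 2 * (k : ℝ) < 11 / 2 → k ≠ 2 → msCex k = 0 := by
    intro k _ hk hk2
    have hk3 : (k : ℝ) < 3 := by linarith
    have : k < 3 := by exact_mod_cast hk3
    show (if k = 2 then (1 : ℝ) / 12 else if k = 3 then 1 / 36 else if k = 5 then 1 / 12 else if k = 6 then 29 / 36 else 0) = 0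
    rw [if_neg hk2, if_neg (by omega), if_neg (by omega), if_neg (by omega)]
  refine (decAtT_singleLow_iff (11 / 12 : ℝ) (11 / 2) 5 (6 + 1) 2 msCex (by norm_num) (by norm_num) msCex_nonneg hνM hν1
    (by norm_num) (by norm_num) hsingle).2 ?_
  -- the capacity inequality
  have e5 : capCoef (11 / 12 : ℝ) (11 / 2) 5 2 5 = 187 / 127 := by
    unfold capCoef
    rw [if_neg (by norm_num), if_pos (by norm_num), usage_msCex_A]; norm_num
  have e6 : capCoef (11 / 12 : ℝ) (11 / 2) 5 2 6 = 1 := by unfold capCoef; rw [if_pos (by norm_num)]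
  have e3 : capCoef (11 / 12 : ℝ) (11 / 2) 5 2 3 = 0 := by
    unfold capCoef; rw [if_neg (by norm_num), if_neg (by norm_num)]
  have e2 : capCoef (11 / 12 : ℝ) (11 / 2) 5 2 2 = 0 := by
    unfold capCoef; rw [if_neg (by norm_num), if_neg (by norm_num)]
  simp only [Finset.sum_range_succ, Finset.sum_range_zero]
  norm_num
  rw [e2, e3, e5, e6]; norm_num

/-- **Hypothesis B**: `shiftBut ν 1 0` is DEC at `(11/12, 11/2 + 1·(1 − 0), 5)` (top `6 + 1`): single charged low `3`, capacity
`11/12 ≤ (187/127)/36 + 1/12 + 29/36`. [this work] -/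
theorem msCex_hypB : DECAtT (11 / 12 : ℝ) (11 / 2 + ((1 : ℕ) : ℝ) * (1 - 0)) 5 (6 + 1) (shiftBut msCex 1 0) := by
  have eT : (11 / 2 : ℝ) + ((1 : ℕ) : ℝ) * (1 - 0) = 13 / 2 := by norm_num
  rw [eT]
  have hW : shiftBut msCex 1 0 = fun h => if h = 3 then (1 : ℝ) / 12 else if h = 4 then 1 / 36 else if h = 6 then 1 / 12 else if h = 7 then 29 / 36 else 0 :=
    funext shiftBut_msCex
  rw [hW]
  have hν0 : ∀ k : ℕ, 0 ≤ (if k = 3 then (1 : ℝ) / 12 else if k = 4 then 1 / 36 else if k = 6 then 1 / 12 else if k = 7 then 29 / 36 else 0) := by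
    intro k; split_ifs <;> norm_num
  have hνM : ∀ k : ℕ, 6 + 1 < k →
      (if k = 3 then (1 : ℝ) / 12 else if k = 4 then 1 / 36 else if k = 6 then 1 / 12 else if k = 7 then 29 / 36 else 0) = 0 := by
    intro k hk; rw [if_neg (by omega), if_neg (by omega), if_neg (by omega), if_neg (by omega)]
  have hν1 : ∑ h ∈ Finset.range (6 + 1 + 1),
      (if h = 3 then (1 : ℝ) / 12 else if h = 4 then 1 / 36 else if h = 6 then 1 / 12 else if h = 7 then 29 / 36 else 0) = 1 := by
    simp [Finset.sum_range_succ]; norm_num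
  have hsingle : ∀ k : ℕ, k ≤ 5 → 2 * (k : ℝ) < 13 / 2 → k ≠ 3 →
      (if k = 3 then (1 : ℝ) / 12 else if k = 4 then 1 / 36 else if k = 6 then 1 / 12 else if k = 7 then 29 / 36 else 0) = 0 := by
    intro k _ hk hk3
    have hk4 : (k : ℝ) < 4 := by linarith
    have : k < 4 := by exact_mod_cast hk4
    rw [if_neg hk3, if_neg (by omega), if_neg (by omega), if_neg (by omega)]
  refine (decAtT_singleLow_iff (11 / 12 : ℝ) (13 / 2) 5 (6 + 1) 3 _ (by norm_num) (by norm_num) hν0 hνM hν1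
    (by norm_num) (by norm_num) hsingle).2 ?_
  have e4 : capCoef (11 / 12 : ℝ) (13 / 2) 5 3 4 = 187 / 127 := by
    unfold capCoef
    rw [if_neg (by norm_num), if_pos (by norm_num), usage_msCex_B]; norm_num
  have e6 : capCoef (11 / 12 : ℝ) (13 / 2) 5 3 6 = 1 := by unfold capCoef; rw [if_pos (by norm_num)]
  have e7 : capCoef (11 / 12 : ℝ) (13 / 2) 5 3 7 = 1 := by unfold capCoef; rw [if_pos (by norm_num)]
  have e3 : capCoef (11 / 12 : ℝ) (13 / 2) 5 3 3 = 0 := by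
    unfold capCoef; rw [if_neg (by norm_num), if_neg (by norm_num)]
  simp only [Finset.sum_range_succ, Finset.sum_range_zero]
  norm_num
  rw [e3, e4, e6, e7]; norm_num

/-! ### The conclusion fails at the witness -/

/-- **the mixture `(1/12)·ν + (11/12)·shiftBut ν 1 0` is NOT DEC at `(11/12, 77/12, 5)`**: weak duality with the price system
`α₂ = α₃ = 1`, `β₄ = 1/7`, `β₅ = 41/247`, `β₆ = β₇ = 1/11`. [this work] -/
theorem msCex_not_conclusion :
    ¬ DECAtT (11 / 12 : ℝ) (11 / 2 + ((1 : ℕ) : ℝ) * (11 / 12) * (1 - 0)) 5 (6 + 1)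
      (fun h => (1 - 11 / 12) * msCex h + 11 / 12 * shiftBut msCex 1 0 h) := by
  have eT : (11 / 2 : ℝ) + ((1 : ℕ) : ℝ) * (11 / 12) * (1 - 0) = 77 / 12 := by norm_num
  rw [eT]
  intro hdec
  have hdual := dual_le_of_decAtT (11 / 12 : ℝ) (77 / 12) 5 (6 + 1) _ (by norm_num) (by norm_num) hdec
    (fun l => if l = 2 ∨ l = 3 then 1 else 0)
    (fun h => if h = 4 then 1 / 7 else if h = 5 then 41 / 247 else if 5 + 1 ≤ h then 1 / 11 else 0)
    (by intro h; split_ifs <;> norm_num) ?_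
  · -- the two sides evaluate to `37/432` and a smaller number
    simp only [Finset.sum_range_succ, Finset.sum_range_zero, shiftBut_msCex] at hdual
    norm_num at hdual
  · -- dual feasibility on compatible pairs
    intro l h hl hlow hh hcomp
    have hβ : (0 : ℝ) ≤ (if h = 4 then 1 / 7 else if h = 5 then 41 / 247 else if 5 + 1 ≤ h then 1 / 11 else 0) := by
      split_ifs <;> norm_num
    by_cases hα : l = 2 ∨ l = 3
    · rw [if_pos hα]
      by_cases hg : 5 + 1 ≤ h
      · rw [usage_msCex_giant _ l h hg, if_neg (by omega), if_neg (by omega), if_pos hg]; norm_num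
      · have hc : (77 / 12 : ℝ) < (l : ℝ) + h := hcomp.resolve_left hg
        have hh5 : h ≤ 5 := by omega
        rcases hα with rfl | rfl
        · -- l = 2: the only compatible mid is 5
          have hc' : (77 / 12 : ℝ) < 2 + (h : ℝ) := by simpa using hc
          have h5 : h = 5 := by
            have : (53 / 12 : ℝ) < h := by linarith
            have : 4 < h := by exact_mod_cast (by linarith : (4 : ℝ) < h)
            omega
          subst h5
          rw [usage_msCex_P25]; norm_num
        · -- l = 3: compatible mids 4 and 5
          have hc' : (77 / 12 : ℝ) < 3 + (h : ℝ) := by simpa using hc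
          have h45 : h = 4 ∨ h = 5 := by
            have : (41 / 12 : ℝ) < h := by linarith
            have : 3 < h := by exact_mod_cast (by linarith : (3 : ℝ) < h)
            omega
          rcases h45 with rfl | rfl
          · rw [usage_msCex_P34]; norm_num
          · rw [usage_msCex_P35]; norm_num
    · rw [if_neg hα]
      have hlh : l < h := by
        rcases hcomp with hg | hc
        · omega
        · have : (l : ℝ) < h := by
            have h2 : 2 * (l : ℝ) < (l : ℝ) + h := lt_trans hlow hc
            linarith
          exact_mod_cast this
      exact mul_nonneg (usage_pos_of_compat (11 / 12 : ℝ) (77 / 12) 5 l h (by norm_num) (by norm_num) hlow hlh hcomp).le hβ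

/-- **`LawDec.MixedShiftDEC` IS FALSE** (the `@[conjecture]` of `…QuantMixedShift`, lead g29): at `y = g = 11/12`, `z = 0`, `a = 1`,
`j = 5`, `M = 6`, `S = 11/2` and the law `msCex` both one-layer hypotheses hold and the conclusion fails.  Witness: prim-quant-arm-3 g62
(V278 second-seat literal test, lane README V313). [this work] -/
theorem not_mixedShiftDEC : ¬ MixedShiftDEC := by
  intro hMS
  have hz : (0 : ℝ) ≤ msCex 0 := msCex_nonneg 0
  have h := hMS (11 / 12 : ℝ) 0 (11 / 12) (11 / 2) 1 5 6 msCex (by norm_num) (by norm_num) le_rfl hz (by norm_num) (by norm_num)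
    le_rfl msCex_nonneg msCex_zero msCex_sum msCex_mean.symm (by norm_num) msCex_hypA msCex_hypB
  exact msCex_not_conclusion h

end LawDec

end Quant

end Summit.CriticalPhenomena.PercolationContinuityZ3.Theorems
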